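import Summits.CriticalPhenomena.SAWScalingLimit.Theses.SAWLoopFugacityFlow
import Literature.Probability.RandomPlanarGeometry.SimpleCurves

/-!
# Negative-side results for the crux `SAWLoopFugacityFlow.SimpleSubseqLimits` (stmt-CriticalPhenomena-4982):
THE SOFT ROAD IS CLOSED — `CurveClass.simple` is not closed under (weak) limits (work-file §4).

The crux asserts that weak subsequential limits of the critical SAW laws (each carried by SIMPLE
lattice polylines) are carried by simple curve classes. The abstract shape of that statement is
FALSE: here are explicit injective curves `shear n : t ↦ min (6t) (4 - 2t) + i t/(n+1)` whose
classes converge in `CurveClass ℂ` to the class of the real "overshoot" curve `0 → 3 → 2`, which is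
NOT simple (it is not flat — it passes `5/2` twice with `3` in between — while every representative
of a simple class is flat, by the tree's description `CurveClass.simple_eq_iInter` through
injectivity moduli). Consequently `CurveClass.simple` is not closed, and Dirac masses at simple
classes converge weakly to a probability measure giving mass `0` to `simple`
(`exists_weakLimit_not_ae_simple`). Simplicity of SAW subsequential limits therefore cannot follow
from weak convergence and lattice self-avoidance alone: a quantitative no-macroscopic-self-touching
estimate at `x_c` is needed.

Refuter `cdisprove` (standing adversary); the full indexed work file is
`Summits/CriticalPhenomena/SAWScalingLimit/Cruxes/SimpleSubseqLimits/Disproof.lean`.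
-/

noncomputable section

open MeasureTheory Filter Topology Set Metric
open Literature.Probability.RandomPlanarGeometry
open scoped ENNReal NNReal BoundedContinuousFunction

namespace Summit.CriticalPhenomena.SAWScalingLimit.Theorems.SimpleSubseqLimits.Negative

/-- The real "overshoot" profile `0 → 3 → 2`: `min (6t) (4 - 2t)`. [folklore] -/
def overshootFun (t : ℝ) : ℝ := min (6 * t) (4 - 2 * t)

/-- `overshootFun` is continuous. [folklore] -/
theorem continuous_overshootFun : Continuous overshootFun := by
  unfold overshootFun; fun_prop

/-- The overshoot curve `t ↦ min (6t) (4 - 2t) ∈ ℝ ⊆ ℂ`: runs `0 → 3 → 2` along the real axis.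
[folklore] -/
def overshoot : Curve ℂ :=
  ⟨⟨fun t => ((overshootFun t : ℝ) : ℂ), by
    have := continuous_overshootFun; fun_prop⟩⟩

/-- Pointwise formula for `overshoot`. [folklore] -/
@[simp] theorem overshoot_apply (t : unitInterval) : overshoot t = ((overshootFun t : ℝ) : ℂ) := rfl

/-- The sheared overshoot curves `t ↦ overshoot t + i t/(n+1)`. [folklore] -/
def shear (n : ℕ) : Curve ℂ :=
  ⟨⟨fun t => ((overshootFun t : ℝ) : ℂ) + Complex.I * (((t : ℝ) / ((n : ℝ) + 1) : ℝ) : ℂ), by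
    have := continuous_overshootFun; fun_prop⟩⟩

/-- Pointwise formula for `shear`. [folklore] -/
@[simp] theorem shear_apply (n : ℕ) (t : unitInterval) :
    shear n t = ((overshootFun t : ℝ) : ℂ) + Complex.I * (((t : ℝ) / ((n : ℝ) + 1) : ℝ) : ℂ) := rfl

/-- The imaginary part of `shear n` is `t/(n+1)`, strictly increasing in `t`. [folklore] -/
theorem shear_im (n : ℕ) (t : unitInterval) : (shear n t).im = (t : ℝ) / ((n : ℝ) + 1) := by
  simp only [shear_apply, Complex.add_im, Complex.ofReal_im, Complex.mul_im, Complex.I_re,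
    Complex.I_im, Complex.ofReal_re]
  ring

/-- The sheared curves are simple (injective). [folklore] -/
theorem shear_isSimple (n : ℕ) : (shear n).IsSimple := by
  intro t t' h
  have him := congrArg Complex.im h
  rw [shear_im, shear_im] at him
  have hn : (0 : ℝ) < (n : ℝ) + 1 := by positivity
  exact Subtype.ext ((div_left_inj' hn.ne').1 him)

/-- Uniform (hence reparametrisation-distance) closeness: `dist (shear n) overshoot ≤ 1/(n+1)`.
[folklore] -/
theorem dist_shear_overshoot_le (n : ℕ) : dist (shear n) overshoot ≤ 1 / ((n : ℝ) + 1) := by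
  refine (Curve.dist_le_dist_toContinuousMap _ _).trans ?_
  refine (ContinuousMap.dist_le (by positivity)).2 fun t => ?_
  change dist (shear n t) (overshoot t) ≤ _
  rw [shear_apply, overshoot_apply, Complex.dist_eq, add_sub_cancel_left, norm_mul,
    Complex.norm_I, one_mul, Complex.norm_real, Real.norm_eq_abs,
    abs_of_nonneg (by have := t.2.1; positivity)]
  exact div_le_div_of_nonneg_right t.2.2 (by positivity)

/-- The classes `mk (shear n)` converge to `mk overshoot`. [folklore] -/
theorem tendsto_mk_shear :
    Tendsto (fun n => CurveClass.mk (shear n)) atTop (𝓝 (CurveClass.mk overshoot)) := by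
  rw [tendsto_iff_dist_tendsto_zero]
  refine squeeze_zero (fun _ => dist_nonneg) (fun n => ?_) tendsto_one_div_add_atTop_nhds_zero_nat
  rw [CurveClass.dist_mk_mk]
  exact dist_shear_overshoot_le n

/-- The overshoot curve is not flat: `γ(5/12) = γ(3/4) = 5/2` but `γ(1/2) = 3`. [folklore] -/
theorem overshoot_not_isFlat : ¬ overshoot.IsFlat := by
  intro h
  have hs : ((5 : ℝ) / 12) ∈ unitInterval := ⟨by norm_num, by norm_num⟩
  have hu : ((1 : ℝ) / 2) ∈ unitInterval := ⟨by norm_num, by norm_num⟩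
  have ht : ((3 : ℝ) / 4) ∈ unitInterval := ⟨by norm_num, by norm_num⟩
  have key := h ⟨_, hs⟩ ⟨_, hu⟩ ⟨_, ht⟩ (Subtype.mk_le_mk.2 (by norm_num))
    (Subtype.mk_le_mk.2 (by norm_num))
  simp only [overshoot_apply, overshootFun, Complex.ofReal_inj] at key
  norm_num at key

/-- Every representative of a simple class is FLAT (injectivity moduli of the tree's
`CurveClass.simple_eq_iInter`). [folklore] -/
theorem isFlat_of_mk_mem_simple {γ : Curve ℂ} (h : CurveClass.mk γ ∈ CurveClass.simple) :
    γ.IsFlat := by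
  rw [CurveClass.simple_eq_iInter] at h
  obtain ⟨-, h⟩ := h
  simp only [mem_iInter, mem_iUnion] at h
  refine Curve.isFlat_of_forall_mem_modulusSet fun ε hε => ?_
  obtain ⟨n, hn⟩ := exists_nat_one_div_lt hε
  obtain ⟨m, hm⟩ := h n
  exact ⟨1 / (m + 1 : ℝ), by positivity,
    Curve.modulusSet_mono hn.le le_rfl (CurveClass.mem_modulusSet_of_mk_mem hm)⟩

/-- The class of the overshoot curve is NOT simple. [folklore] -/
theorem mk_overshoot_not_mem_simple : CurveClass.mk overshoot ∉ CurveClass.simple := fun h =>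
  overshoot_not_isFlat (isFlat_of_mk_mem_simple h)

/-- **`CurveClass.simple` is not closed**: the simple classes `mk (shear n)` converge to the
non-simple class `mk overshoot`. [folklore] -/
theorem simple_not_isClosed : ¬ IsClosed (CurveClass.simple : Set (CurveClass ℂ)) := fun h =>
  mk_overshoot_not_mem_simple (h.mem_of_tendsto tendsto_mk_shear
    (Eventually.of_forall fun n => CurveClass.mk_mem_simple (shear_isSimple n)))

/-- **Measure form — the abstract shape of the crux is false.** Probability measures carried by
simple classes (Dirac masses at `mk (shear n)`) converge weakly, on all bounded continuous test
functions, to a probability measure carried by a NON-simple class. [folklore] -/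
theorem exists_weakLimit_not_ae_simple :
    ∃ (P : ℕ → Measure (CurveClass ℂ)) (ν : Measure (CurveClass ℂ)),
      (∀ n, IsProbabilityMeasure (P n)) ∧ (∀ n, ∀ᵐ γ ∂P n, γ ∈ CurveClass.simple) ∧
      IsProbabilityMeasure ν ∧
      (∀ f : CurveClass ℂ →ᵇ ℝ, Tendsto (fun n => ∫ x, f x ∂P n) atTop (𝓝 (∫ x, f x ∂ν))) ∧
      ∀ᵐ γ ∂ν, γ ∉ CurveClass.simple := by
  refine ⟨fun n => Measure.dirac (CurveClass.mk (shear n)), Measure.dirac (CurveClass.mk overshoot),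
    fun n => inferInstance, fun n => ?_, inferInstance, fun f => ?_, ?_⟩
  · rw [ae_dirac_eq, eventually_pure]
    exact CurveClass.mk_mem_simple (shear_isSimple n)
  · simp only [integral_dirac]
    exact (f.continuous.tendsto _).comp tendsto_mk_shear
  · rw [ae_dirac_eq, eventually_pure]
    exact mk_overshoot_not_mem_simple

/-- Link to the crux: its conclusion set `CurveClass.simple ∩ {boundary avoidance}` fails to be
closed already through the first factor, so the crux (`SimpleSubseqLimits`, whose conclusion
begins with `γ ∈ CurveClass.simple`) admits no proof by closedness/portmanteau — in contrast with
its endpoint and confinement clauses. Stated as: the crux's simplicity clause is not a closed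
event. [folklore] -/
theorem simpleSubseqLimits_conclusion_not_closed :
    ¬ IsClosed {γ : CurveClass ℂ | γ ∈ CurveClass.simple} :=
  simple_not_isClosed

end Summit.CriticalPhenomena.SAWScalingLimit.Theorems.SimpleSubseqLimits.Negative
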